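import Summits.HodgeConjecture.HodgeCM.PerL34.FockPrintKTypes_1

/-! PORT of `HodgeCM/PerL34/FockPrintKTypes.lean` (HodgeCMPerL run 82) — part 2: continuation of `Summits.HodgeConjecture.HodgeCM.PerL34.FockPrintKTypes_1` (split at a top-level declaration boundary by port_pkg.py; scope re-opened below; declarations unchanged). -/

-- port_pkg: scope re-opened for this part (file-level context, then the namespace/section stack open at the cut)
set_option autoImplicit false
namespace HodgeCM
namespace PerL34
namespace Fock
namespace PrintDict
open MvPolynomial Complex
open scoped BigOperators
section D12
/-- The two images commute at `D₁₂` (KERNEL; the dual pair `(U(3), U(2))`). -/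
theorem kronV_mul_kronW (A : Matrix (Fin 3) (Fin 3) ℂ) (B : Matrix (Fin 2) (Fin 2) ℂ) :
    kronV A * kronW B = kronW B * kronV A := by
  ext ⟨a, j⟩ ⟨b, j'⟩
  simp only [Matrix.mul_apply, Fintype.sum_prod_type, kronV_apply, kronW_apply, mul_ite, ite_mul, mul_zero,
    zero_mul, Fin.sum_univ_three, Fin.sum_univ_two]
  fin_cases a <;> fin_cases b <;> fin_cases j <;> fin_cases j' <;> simp [mul_comm]

/-- **MAIN COMPUTATION at `D₁₂`, `U(W)`-side (KERNEL)**: for `B ∈ 𝔤𝔩₂ = 𝔲(2)_ℂ` and every `λ`, Adams's Fock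
operator of `ρ(1 ⊗ B)` on `ℂ[M_{3×2}]` is `Σ_{j,j′} B_{jj′} Σ_a z_{aj}∂_{aj′} + (3/2) tr B` — the constants have
`K̃′ = Ũ(2)`-weight `(p/2, p/2) = (3/2, 3/2)`, i.e. `det^{3/2}` ([chunk p0023 L22] with `n = 0`). -/
theorem fockOp_rho_kronW (lam : ℂ) (B : Matrix (Fin 2) (Fin 2) ℂ) :
    fockOp (sf eqWt) (ee eqWt) (ff eqWt) lam (rho eqWt (kronW B)) =
      ∑ j, ∑ j', B j j' • (∑ a : Fin 3, mz (σ := EqVar) (a, j) * dz (a, j'))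
        + ((3 / 2 : ℂ) * B.trace) • (1 : Module.End ℂ EqModel) := by
  rw [fockOp_apply]
  simp only [bA_eq, bB_eq, bC_eq, zero_smul, Finset.sum_const_zero, smul_zero, add_zero, sub_zero,
    Fintype.sum_prod_type, kronW_apply, Matrix.trace, Matrix.diag_apply]
  simp only [Fin.sum_univ_three, Fin.sum_univ_two, Fin.isValue, if_true, smul_add]
  simp
  module

/-- On the constants `ρ(1 ⊗ B)` is the scalar `(3/2) tr B` (KERNEL): the vacuum line is `det^{3/2}` of `Ũ(2)`. -/
theorem fockOp_rho_kronW_C (lam : ℂ) (B : Matrix (Fin 2) (Fin 2) ℂ) (c : ℂ) :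
    fockOp (sf eqWt) (ee eqWt) (ff eqWt) lam (rho eqWt (kronW B)) (C c) = ((3 / 2 : ℂ) * B.trace) • C c := by
  rw [fockOp_rho_kronW, LinearMap.add_apply, LinearMap.smul_apply, Module.End.one_apply]
  simp [LinearMap.coe_sum, Module.End.mul_apply, dz_apply]

/-- **Prop. 6.6 at `D₁₂` for `σ = det` (KERNEL)**: a vector of `ℂ[M_{3×2}]` has the printed `Ũ(3)`-torus weight
`(1,1,1)` of the vacuum — `ρ(E_{aa} ⊗ 1) f = f` for all `a` — iff it is a constant; the constants form ONE line on
which `Ũ(2)` acts by `det^{3/2}` (`fockOp_rho_kronW_C`).  (`ArchB` §E `eq_C_of_eqTorus` is the `⇒`.) -/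
theorem weightDet_iff (lam : ℂ) (f : EqModel) :
    (∀ a, fockOp (sf eqWt) (ee eqWt) (ff eqWt) lam (rho eqWt (kronV (Matrix.single a a 1))) f = f) ↔
      f = C (coeff 0 f) := by
  rw [← eqTorus_iff_fockOp]
  constructor
  · exact eq_C_of_eqTorus f
  · intro h a
    rw [h]
    simp [weightOp_apply]

end D12

end PrintDict
end Fock
end PerL34
end HodgeCM
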